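import Summits.QuantumFields.BalabanUV.Beta.GAN24.CovariantCurveTaylor
import Summits.QuantumFields.BalabanUV.Beta.GAN24.CouplingDiagramsAtCoupling
import Summits.QuantumFields.BalabanUV.Beta.GAN24.CouplingPerturbedVolumeLimit
import Summits.QuantumFields.BalabanUV.Beta.GAN24.CouplingLetterStencil

/-!
# `BalabanUV.Beta.GAN24.CovariantCurveTaylorAtBase` — binder row G-an2-4 ∕ (CONV-C), route R7 «TWO CURRENCIES», leaf lane (η′) «THE ONE-PARAMETER TOWER AT THE BASE POINT», PART 1∕2:
# PARTs 241 ∕ 242 AT A BASE POINT.  EVERY s-DERIVATIVE AT `s = 0` OF THE INVERSE EFFECTIVE COVARIANCE `(L^{dk}Q_k(Δ_a^{(k)} + A(s))⁻¹Q_kᴴ)⁻¹` ALONG A REAL CURVE OF COUPLING LETTERS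
# `A(s) = P(V(s)) + P(V(s))ᴴ + diag Z(s)` THROUGH A SMALL BASE LETTER `A(0) = A₀` (NOT through the free operator: PART 241 is `A₀ = 0`) HAS THE β-CELL's WHOLE `LimitRate` END ON `ℤ^d`:
# PART 240's uniform Faà di Bruno at `s = 0` gives ONE finite `ℤ`-combination of diagrams whose letters are the VALUE letter `c_k(A₀)⁻¹` and the words
# `𝒢₀·A^{(j₁)}(0)·𝒢₀⋯𝒢₀` in the PERTURBED propagator `𝒢₀ = (Δ_a + A₀)⁻¹` and the jets `A^{(j)}(0)`, `1 ≤ j ≤ N`; PART 264 (every diagram in coupling letters at a base point on the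
# three-condition disc, coupling `u = 1`) is its END modulo EL₁; the two invertibilities PART 240 displays (`Δ_a + A₀`, `c_k(A₀)`) are DISCHARGED on the disc by NE2's Neumann bound
# (`isUnit_det_add_smul_right` on PART 236's `perturbationLaws_couplingLetter`) and PART 249's ratio `‖1 − Cst⁻¹c_k(A₀)‖ ≤ 1 − γ_B∕(2Cst) < 1`.  §2 is the instance along a smooth
# transporter curve `U_{t,s}` through an ARBITRARY small base transporter `U_{t,0}` (`A(s) = Δ^{U_{t,s}} − Δ^1 = covPert U_{t,s}`, NE2's `covPert_eq`; PART 242 is `U_{t,0} = 1`).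
# Displayed, exactly as PART 264 ∕ PART 269 display them: `(α₀, β₀)` ∕ `(α₀′, β₀′)` of the base letter with the three smallness conditions at coupling `1`, the three CT-disc conditions,
# `(α, β)` ∕ `(α′, β′)` of the jets `j ≤ N` uniformly in the volume, and EL₁ of the jets (unit b2b-balaban-gan24-formalise-leaf-01, gen 94; v1; road-P3 g67's cut (η′), journal l.68353)

NOT IN PRINT; OUR PROOF ([folklore] bookkeeping BY NAME over PART 240 (`iteratedDeriv_inv_eq_curveDiagramSum`), PART 241 (`hasDerivAt_couplingLetter_curve`), PART 242
(`hasDerivAt_iteratedDeriv_scalar`, `contDiff_conn`, `contDiff_zfield`), PART 264 (`conv_couplingDiagramSumAt_of_tendsto_background`), PART 249 (`opNorm_one_sub_smul_pertCov_le_coupling`),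
PART 236 (`perturbationLaws_couplingLetter`), PART 161 (`exists_clm_avgTow`), NE2's `covPert_eq`, `isUnit_det_add_smul_right`, `isUnit_one_add_of_opNorm_lt_one`, `isUnit_det_calDalev`,
`one_sub_smul_reindex`, `opNorm_reindex`; [Balaban1985BackgroundPropagators] (3.3) p. 390, (3.35) p. 396 and [Balaban1987RG1] (1.20)–(1.22) p. 264 LOCATE the shapes; nothing printed is a
hypothesis).
HONEST FRAMING (cell contract, verbatim): «discharging `BetaPertH` makes Bałaban's UV stability UNCONDITIONAL — a real constructive-QFT result; it is NOT the
continuum limit and NOT the Clay problem.»  HONEST DEPENDENCY (verbatim): «continuum YM on T⁴ ⇐ BetaPertH ∧ nine spine estimates (0/9 proved); BetaPertH ⇐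
(D1) ∧ (D4) ∧ CAP+tail; G-an2-4 gates asym, D1 and NE2/3/4.»

WHAT THIS FILE PROVES (0 sorry, 0 `def`; `d ≥ 3`, `L ≥ 2`, `a > 0`, `μ ≠ ν`, even cubic volumes `2(t+1)`, every order `N`):
* §1 **`conv_iteratedDeriv_invPertCov_couplingCurveAt_of_tendsto_background`** — PART 241 at a base letter: entrywise jet towers `V^{(j)}_t(s)`, `Z^{(j)}_t(s)`; the base letter
  `(V^{(0)}_t(0), Z^{(0)}_t(0))` Lipschitz `(α₀, β₀)` ∕ bounded `(α₀′, β₀′)` on the disc; the jets `j ≤ N` at `s = 0` Lipschitz `(α, β)` ∕ bounded `(α′, β′)` uniformly in `t` with EL₁;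
  THEN `(t, k) ↦ ∂^N_s[(L^{dk}Q_k(Δ_a^{(k)} + P(V^{(0)}_t(s)) + P(V^{(0)}_t(s))ᴴ + diag Z^{(0)}_t(s))⁻¹Q_kᴴ)⁻¹]|_{s=0}` has `∃ κ₁ > 0, B, B′ ≥ 0, Π` with `IsInfiniteVolumeLimit`, `UniformDecay`,
  `StepRate (√(L⁻¹))`, `KernelInputs`, `|secondMoment (Π k) − secondMoment (lim Π)| ≤ β′_d(B′∕(1−√(L⁻¹)), κ₁∕d)(√(L⁻¹))^k`.
* §2 **`conv_iteratedDeriv_invCov_covariantCurveAt_of_tendsto`** — PART 242 at a base transporter: a smooth transporter curve `U_{t,s}` with `−w(U_{t,0})` Lipschitz `(α₀, β₀)` and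
  `z(U_{t,0})` bounded `(α₀′, β₀′)` on the disc, the iterated-derivative jets of `−w(U_{t,s})`, `z(U_{t,s})` at `s = 0` displayed as in PART 242; the same END for
  `∂^N_s[(L^{dk}Q_k(Δ_a^{(k)} + (Δ^{U_{t,s}} − Δ^1))⁻¹Q_kᴴ)⁻¹]|_{s=0}`.
WHAT IT DOES NOT DO: the exponential chart `exp(iη(A₀ + sX))` at the base point with its jets in closed form (PART 2∕2 `ExponentialChartBaseCovariantTaylorLine`); several parameters
(PARTs 268∕269); base letters outside the disc (large fields); colour; Bałaban's `−∂P∂*` ∕ `aQ(U)*Q(U)` parts.  SUPPLIER work; NEVER «G-an2-4 closed»; NOT (CONV-C), NOT D1, NOT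
`BetaPertH`, NOT continuum, NOT Clay.  Records: `HOME/b2b-balaban-gan24-formalise-leaf-01/g94/README-g94.md`.
-/

noncomputable section

open scoped BigOperators ComplexConjugate Matrix Matrix.Norms.L2Operator
open Filter Topology

namespace Summit.QuantumFields.BalabanUV.Beta.GAN24.CovariantCurveTaylorAtBase

open Literature.MathematicalPhysics.QuantumFieldTheory.Balaban1983to89
open Literature.MathematicalPhysics.QuantumFieldTheory.Balaban1983to89.B5Prop11Plancherel (Tor fine Cst opNorm_reindex)
open Literature.MathematicalPhysics.QuantumFieldTheory.Balaban1983to89.B5G183RateUnitTower (lev)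
open Literature.MathematicalPhysics.QuantumFieldTheory.Balaban1983to89.B12Sec2to5 (betaPrime510)
open Literature.MathematicalPhysics.QuantumFieldTheory.Balaban1983to89.Beta (Site IsInfiniteVolumeLimit)
open Literature.MathematicalPhysics.QuantumFieldTheory.Balaban1983to89.Beta.FreeLegDictionary (cubic)
open Literature.MathematicalPhysics.QuantumFieldTheory.Balaban1983to89.Beta.BlockKernelVolumeSockets (evenPeriod)
open Literature.MathematicalPhysics.QuantumFieldTheory.Balaban1983to89.Beta.VectorTails (castT)
open Literature.MathematicalPhysics.QuantumFieldTheory.Balaban1983to89.Beta.LimitRate (StepRate limKernelOf KernelInputs)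
open Summit.QuantumFields.BalabanUV.T4Continuum
open Summit.QuantumFields.BalabanUV.T4Continuum.CovariantAveragingTower (avgTow)
open Summit.QuantumFields.BalabanUV.T4Continuum.BalabanAveragedTowerUnit (idx QBlev)
open Summit.QuantumFields.BalabanUV.T4Continuum.BalabanAveragedCoerciveTower (unitIdx)
open Summit.QuantumFields.BalabanUV.T4Continuum.BalabanAveragedCoercive (gammaB gammaB_pos)
open Summit.QuantumFields.BalabanUV.T4Continuum.KingPairingPlantedLaw (calDalev isUnit_det_calDalev)
open Summit.QuantumFields.BalabanUV.T4Continuum.FirstOrderBackgroundModel (LipschitzBackground Pmodel)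
open Summit.QuantumFields.BalabanUV.T4Continuum.PerturbationAlgebra (BoundedBackground)
open Summit.QuantumFields.BalabanUV.T4Continuum.AbelianCovariantLaplacian (covPert covPert_eq connV zT negConn)
open Summit.QuantumFields.BalabanUV.T4Continuum.BackgroundResolventLaw (isUnit_det_add_smul_right isUnit_one_add_of_opNorm_lt_one)
open Summit.QuantumFields.BalabanUV.T4Continuum.CTConjugatedHbd (G2)
open Summit.QuantumFields.BalabanUV.T4Continuum.DirichletRegionTower (gamD)
open Summit.QuantumFields.BalabanUV.T4Continuum.ScalarAveragedPropagator (gammaPs)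
open Summit.QuantumFields.BalabanUV.T4Continuum.ScalarAveragedCompression (sigma0)
open Summit.QuantumFields.BalabanUV.T4Continuum.CTScalarGreen (Jfree)
open Summit.QuantumFields.BalabanUV.T4Continuum.CTGaugeTerm (deltaK)
open Summit.QuantumFields.BalabanUV.T4Continuum.CTVectorPropagator (JA)
open Summit.QuantumFields.BalabanUV.Beta.GAN24.VolumeLimitCovariance (one_sub_smul_reindex)
open Summit.QuantumFields.BalabanUV.Beta.GAN24.BackgroundExpansionTaylor (exists_clm_avgTow)
open Summit.QuantumFields.BalabanUV.Beta.GAN24.ResolventCurveTaylor (iteratedDeriv_inv_eq_curveDiagramSum)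
open Summit.QuantumFields.BalabanUV.Beta.GAN24.CouplingCurveTaylor (hasDerivAt_couplingLetter_curve)
open Summit.QuantumFields.BalabanUV.Beta.GAN24.CovariantCurveTaylor (hasDerivAt_iteratedDeriv_scalar contDiff_conn contDiff_zfield)
open Summit.QuantumFields.BalabanUV.Beta.GAN24.CouplingLetterStencil (perturbationLaws_couplingLetter)
open Summit.QuantumFields.BalabanUV.Beta.GAN24.CouplingPerturbedVolumeLimit (opNorm_one_sub_smul_pertCov_le_coupling)
open Summit.QuantumFields.BalabanUV.Beta.GAN24.CouplingDiagramsAtCoupling (conv_couplingDiagramSumAt_of_tendsto_background)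

variable {d : ℕ} (L : ℕ) [NeZero L] (a : ℝ) (ha : 0 < a)

/-! ## §1 The END along a curve of coupling letters through a small BASE letter, modulo only EL₁ of the first `N` jets at `s = 0` -/

section Curve

/-- **`conv_iteratedDeriv_invPertCov_couplingCurveAt_of_tendsto_background` — EVERY s-DERIVATIVE AT `s = 0` OF `(c_k(s))⁻¹` ALONG A REAL CURVE OF COUPLING LETTERS THROUGH A SMALL
BASE LETTER, ON `ℤ^d`, MODULO ONLY EL₁ OF THE JETS** [our proof] (`d ≥ 3`, `L ≥ 2`, `a > 0`, `μ ≠ ν`, even cubic volumes `2(t+1)`, order `N`).  Data: entrywise jet towers `V^{(j)}_t(s)`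
(connections) and `Z^{(j)}_t(s)` (zeroth-order fields) on every level of every volume; the BASE LETTER `(V^{(0)}_t(0), Z^{(0)}_t(0))` is Lipschitz `(α₀, β₀)` ∕ bounded `(α₀′, β₀′)` uniformly
in `t` on the three-condition disc at coupling `1` (PART 264's `hT₁ hT₂ hT₃` at `T = 1`, `hγ' hδ' hJA`); for `j ≤ N` the jets at `s = 0` are Lipschitz `(α, β)` ∕ bounded `(α′, β′)` backgrounds
uniformly in `t` with EL₁ (`j = 0` included: the base letter's EL₁).  THEN the tower family `(t, k) ↦ ∂^N_s[(L^{dk}Q_k(Δ_a^{(k)} + P(V^{(0)}_t(s)) + P(V^{(0)}_t(s))ᴴ + diag Z^{(0)}_t(s))⁻¹Q_kᴴ)⁻¹]|_{s=0}`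
has the β-cell's whole `LimitRate` END: PART 240's uniform curve Faà di Bruno at `s = 0` — letters `c_k(A₀)⁻¹` and the words `𝒢₀A^{(j₁)}(0)𝒢₀⋯𝒢₀` in the PERTURBED propagator
`𝒢₀ = (Δ_a + A₀)⁻¹`, `1 ≤ j ≤ N` — + PART 264's END at coupling `u = 1` on the finite alphabet `Fin (N+1)` (`i ↦ A^{(i)}(0)`); the two invertibilities PART 240 displays are discharged on
the disc (NE2's Neumann bound on PART 236's letter laws; PART 249's ratio `‖1 − Cst⁻¹c_k(A₀)‖ ≤ 1 − γ_B∕(2Cst)`).  PART 241 is the case `A₀ = 0`.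
[cite: Balaban1985BackgroundPropagators, (3.3) p.390 (covariant derivative, shape); Balaban1987RG1, (1.21)–(1.22) p.264 (shapes)] -/
theorem conv_iteratedDeriv_invPertCov_couplingCurveAt_of_tendsto_background (hL : 2 ≤ L) (hd : 3 ≤ d) {μ ν : Fin d} (hne : μ ≠ ν)
    {α₀ β₀ α₀' β₀' α β α' β' a' κ : ℝ} (ha' : 0 < a') (hκ0 : 0 < κ)
    (hγ' : Jfree d a' κ 1 < gammaPs d a') (hδ' : deltaK d a' κ 1 < sigma0 d a' ^ 2) (hJA : JA d a a' κ 1 < gamD d a)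
    (hT₁ : 1 * (2 * (d * (α₀ + β₀) * Cst d a) + α₀' * Cst d a) ≤ 1 / 2)
    (hT₂ : 1 * (d * (α₀ * G2 d a (max (JA d a a' κ 1) 0) (gamD d a - max (JA d a a' κ 1) 0) κ)
      + d * (Real.exp |κ| * (α₀ * G2 d a (max (JA d a a' κ 1) 0) (gamD d a - max (JA d a a' κ 1) 0) κ + β₀ * (gamD d a - max (JA d a a' κ 1) 0)⁻¹))
      + α₀' * (gamD d a - max (JA d a a' κ 1) 0)⁻¹) ≤ 1 / 2)
    (hT₃ : 4 * 1 * (2 * (d * (α₀ + β₀) * Cst d a) + α₀' * Cst d a) * Cst d a ≤ gammaB d a) (N : ℕ)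
    {V : ℕ → (t : ℕ) → ℝ → (k : ℕ) → Fin d → (idx L (cubic d (evenPeriod t)) k → ℂ)} {Z : ℕ → (t : ℕ) → ℝ → (k : ℕ) → (idx L (cubic d (evenPeriod t)) k → ℂ)}
    (hVd : ∀ j t s k μ x, HasDerivAt (fun v => V j t v k μ x) (V (j + 1) t s k μ x) s) (hZd : ∀ j t s k x, HasDerivAt (fun v => Z j t v k x) (Z (j + 1) t s k x) s)
    (hV₀ : ∀ t, LipschitzBackground L (cubic d (evenPeriod t)) (V 0 t 0) α₀ β₀) (hZ₀ : ∀ t, BoundedBackground L (cubic d (evenPeriod t)) (Z 0 t 0) α₀' β₀')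
    (hV : ∀ j, j ≤ N → ∀ t, LipschitzBackground L (cubic d (evenPeriod t)) (V j t 0) α β) (hZ : ∀ j, j ≤ N → ∀ t, BoundedBackground L (cubic d (evenPeriod t)) (Z j t 0) α' β')
    (hV1 : ∀ j, j ≤ N → ∀ k (μ f : Fin d) (z : Fin d → ℤ), ∃ s : ℂ, Tendsto (fun t => V j t 0 k μ (castT (cubic d (lev L k * evenPeriod t)) z, f)) atTop (𝓝 s))
    (hZ1 : ∀ j, j ≤ N → ∀ k (f : Fin d) (z : Fin d → ℤ), ∃ s : ℂ, Tendsto (fun t => Z j t 0 k (castT (cubic d (lev L k * evenPeriod t)) z, f)) atTop (𝓝 s)) :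
    ∃ κ₁ B B' : ℝ, 0 < κ₁ ∧ 0 ≤ B ∧ 0 ≤ B' ∧ ∃ Pinf : ℕ → B12Beta.Kernel d,
      (∀ k, IsInfiniteVolumeLimit evenPeriod
        (fun t μ' ν' (z : Site d (evenPeriod t)) =>
          ((iteratedDeriv N (fun s : ℝ => (avgTow (QBlev L (cubic d (evenPeriod t))) ((L : ℝ) ^ d)
              (fun k' => (calDalev L (cubic d (evenPeriod t)) a ha k'
                + (Pmodel L (cubic d (evenPeriod t)) (V 0 t s) k' + (Pmodel L (cubic d (evenPeriod t)) (V 0 t s) k')ᴴ + Matrix.diagonal (Z 0 t s k')))⁻¹) k)⁻¹) 0)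
            ((unitIdx L (cubic d (evenPeriod t))).symm (z, μ')) ((unitIdx L (cubic d (evenPeriod t))).symm (0, ν'))).re) (Pinf k)) ∧
      Beta.LimitRate.UniformDecay Pinf μ ν B (κ₁ / d) ∧ StepRate Pinf μ ν B' (κ₁ / d) (Real.sqrt ((L : ℝ)⁻¹)) ∧
      (∃ K : KernelInputs d Pinf, K.θ = Real.sqrt ((L : ℝ)⁻¹) ∧ K.c₀ = betaPrime510 d (B' / (1 - Real.sqrt ((L : ℝ)⁻¹))) (κ₁ / d) ∧ K.Pinf = limKernelOf Pinf ∧ K.μ = μ ∧ K.ν = ν) ∧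
      (∀ k, |B12Beta.secondMoment (Pinf k) μ ν - B12Beta.secondMoment (limKernelOf Pinf) μ ν|
          ≤ betaPrime510 d (B' / (1 - Real.sqrt ((L : ℝ)⁻¹))) (κ₁ / d) * Real.sqrt ((L : ℝ)⁻¹) ^ k) := by
  have hd1 : 1 ≤ d := le_trans (by norm_num) hd
  have hα₀ : 0 ≤ α₀ := (hV₀ 0).nonneg.1
  have hβ₀ : 0 ≤ β₀ := (hV₀ 0).nonneg.2
  have hα₀' : 0 ≤ α₀' := (hZ₀ 0).nonneg.1
  have hβ₀' : 0 ≤ β₀' := (hZ₀ 0).nonneg.2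
  have hα : 0 ≤ α := (hV 0 (Nat.zero_le _) 0).nonneg.1
  have hβ : 0 ≤ β := (hV 0 (Nat.zero_le _) 0).nonneg.2
  have hα' : 0 ≤ α' := (hZ 0 (Nat.zero_le _) 0).nonneg.1
  have hβ' : 0 ≤ β' := (hZ 0 (Nat.zero_le _) 0).nonneg.2
  have hu : ‖(1 : ℂ)‖ ≤ 1 := by rw [norm_one]
  obtain ⟨J, hJ, z, ℓ, hℓ, hN⟩ := iteratedDeriv_inv_eq_curveDiagramSum N
  -- the finite alphabet of jets `i ↦ A^{(i)}(0)`, `i : Fin (N+1)`, and the truncation of word letters (the identity on the letters that occur)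
  set τ : ℕ → Fin (N + 1) := fun j => ⟨min j N, by omega⟩ with hτ
  have hτv : ∀ j, j ≤ N → ((τ j : Fin (N + 1)) : ℕ) = j := fun j hj => by simp [hτ, Nat.min_eq_left hj]
  -- PART 264's END at coupling `1` for the truncated combination
  obtain ⟨κ₁, B, B', hκ₁, hB, hB', Pinf, hIVL, hUD, hSR, hK, hsm⟩ :=
    conv_couplingDiagramSumAt_of_tendsto_background L a ha hL hd (σ := Fin (N + 1)) hα₀ hβ₀ hα₀' hβ₀' hα hβ hα' hβ' ha' hκ0 hγ' hδ' hJA zero_le_one hT₁ hT₂ hT₃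
      (U₁ := fun t => V 0 t 0) (U₂ := fun t => V 0 t 0) (Z := fun t => Z 0 t 0) hV₀ hV₀ hZ₀
      (hV1 0 (Nat.zero_le _)) (hV1 0 (Nat.zero_le _)) (hZ1 0 (Nat.zero_le _))
      (V₁ := fun i t => V (i : ℕ) t 0) (V₂ := fun i t => V (i : ℕ) t 0) (W := fun i t => Z (i : ℕ) t 0)
      (fun i t => hV i (Nat.lt_succ_iff.mp i.2) t) (fun i t => hV i (Nat.lt_succ_iff.mp i.2) t) (fun i t => hZ i (Nat.lt_succ_iff.mp i.2) t)
      (fun i k => hV1 i (Nat.lt_succ_iff.mp i.2) k) (fun i k => hV1 i (Nat.lt_succ_iff.mp i.2) k) (fun i k => hZ1 i (Nat.lt_succ_iff.mp i.2) k)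
      hu hne Finset.univ (fun i => (z i : ℂ)) (fun i => (ℓ i).map (Option.map (List.map τ)))
  refine ⟨κ₁, B, B', hκ₁, hB, hB', Pinf, fun k => ?_, hUD, hSR, hK, hsm⟩
  -- the identity at `s = 0`, volume by volume: PART 240 at the base letter, both invertibilities discharged on the disc
  have key : ∀ t, iteratedDeriv N (fun s : ℝ => (avgTow (QBlev L (cubic d (evenPeriod t))) ((L : ℝ) ^ d)
        (fun k' => (calDalev L (cubic d (evenPeriod t)) a ha k'
          + (Pmodel L (cubic d (evenPeriod t)) (V 0 t s) k' + (Pmodel L (cubic d (evenPeriod t)) (V 0 t s) k')ᴴ + Matrix.diagonal (Z 0 t s k')))⁻¹) k)⁻¹) 0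
      = (∑ i ∈ Finset.univ, (z i : ℂ) • ((((ℓ i).map (Option.map (List.map τ))).map fun o => o.elim
          (fun t k => (avgTow (QBlev L (cubic d (evenPeriod t))) ((L : ℝ) ^ d)
            (fun k' => (calDalev L (cubic d (evenPeriod t)) a ha k'
              + (1 : ℂ) • (Pmodel L (cubic d (evenPeriod t)) (V 0 t 0) k' + (Pmodel L (cubic d (evenPeriod t)) (V 0 t 0) k')ᴴ + Matrix.diagonal (Z 0 t 0 k')))⁻¹) k)⁻¹)
          (fun w t k => avgTow (QBlev L (cubic d (evenPeriod t))) ((L : ℝ) ^ d)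
            (fun k' => List.foldr (fun (i : Fin (N + 1)) Nm =>
                (calDalev L (cubic d (evenPeriod t)) a ha k'
                  + (1 : ℂ) • (Pmodel L (cubic d (evenPeriod t)) (V 0 t 0) k' + (Pmodel L (cubic d (evenPeriod t)) (V 0 t 0) k')ᴴ + Matrix.diagonal (Z 0 t 0 k')))⁻¹
                * (Pmodel L (cubic d (evenPeriod t)) (V (i : ℕ) t 0) k' + (Pmodel L (cubic d (evenPeriod t)) (V (i : ℕ) t 0) k')ᴴ + Matrix.diagonal (Z (i : ℕ) t 0 k')) * Nm)
              (calDalev L (cubic d (evenPeriod t)) a ha k'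
                + (1 : ℂ) • (Pmodel L (cubic d (evenPeriod t)) (V 0 t 0) k' + (Pmodel L (cubic d (evenPeriod t)) (V 0 t 0) k')ᴴ + Matrix.diagonal (Z 0 t 0 k')))⁻¹ w) k)).prod)) t k := by
    intro t
    set M := cubic d (evenPeriod t) with hM
    obtain ⟨Φ, hΦ⟩ := exists_clm_avgTow (QBlev L M) ((L : ℝ) ^ d) k
    -- invertibility of `Δ_a + A₀` (NE2's Neumann bound on PART 236's letter laws, coupling `1`)
    have hC : 0 < Cst d a := lt_of_lt_of_le zero_lt_one (le_max_of_le_right (le_max_right _ _))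
    have hκ₀0 : 0 ≤ 2 * (d * (α₀ + β₀) * Cst d a) + α₀' * Cst d a := by have := hC.le; positivity
    have ht1 : ‖(1 : ℂ)‖ * (2 * (d * (α₀ + β₀) * Cst d a) + α₀' * Cst d a) < 1 := by rw [norm_one]; linarith
    have h0 : IsUnit (calDalev L M a ha k + (Pmodel L M (V 0 t 0) k + (Pmodel L M (V 0 t 0) k)ᴴ + Matrix.diagonal (Z 0 t 0 k))).det := by
      have h := isUnit_det_add_smul_right (isUnit_det_calDalev L M a ha k)
        ((perturbationLaws_couplingLetter L M a ha hd1 (hV₀ t) (hV₀ t) (hZ₀ t)).opNorm_P_mul_inv_le k) ht1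
      rw [one_smul] at h
      exact h
    -- invertibility of `c_k(A₀)` (PART 249's ratio at coupling `1`: `‖1 − Cst⁻¹c_k(A₀)‖ ≤ 1 − γ_B∕(2Cst) < 1`)
    have hc0' : IsUnit (avgTow (QBlev L M) ((L : ℝ) ^ d)
        (fun k' => (calDalev L M a ha k' + (Pmodel L M (V 0 t 0) k' + (Pmodel L M (V 0 t 0) k')ᴴ + Matrix.diagonal (Z 0 t 0 k')))⁻¹) k).det := by
      have h := opNorm_one_sub_smul_pertCov_le_coupling L M a ha hd1 (hV₀ t) (hV₀ t) (hZ₀ t) hT₁ hT₃ hu k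
      rw [one_sub_smul_reindex, opNorm_reindex] at h
      simp only [one_smul] at h
      have hlt : 1 - gammaB d a / (2 * Cst d a) < 1 := by
        have := div_pos (gammaB_pos (d := d) a ha) (mul_pos two_pos hC)
        linarith
      have h1 := isUnit_one_add_of_opNorm_lt_one (X := -((1 : Matrix (idx L M 0) (idx L M 0) ℂ) - (((Cst d a)⁻¹ : ℝ) : ℂ) •
        avgTow (QBlev L M) ((L : ℝ) ^ d) (fun k' => (calDalev L M a ha k' + (Pmodel L M (V 0 t 0) k' + (Pmodel L M (V 0 t 0) k')ᴴ + Matrix.diagonal (Z 0 t 0 k')))⁻¹) k))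
        (by rw [norm_neg]; exact h.trans_lt hlt)
      rw [show ∀ (Y : Matrix (idx L M 0) (idx L M 0) ℂ) (c : ℂ), (1 : Matrix (idx L M 0) (idx L M 0) ℂ) + -(1 - c • Y) = c • Y from fun Y c => by abel,
        Matrix.isUnit_iff_isUnit_det, Matrix.det_smul] at h1
      exact isUnit_of_mul_isUnit_right h1
    set D : Matrix (idx L M k) (idx L M k) ℂ := calDalev L M a ha k with hD
    set Pd : ℕ → ℝ → Matrix (idx L M k) (idx L M k) ℂ := fun j s => Pmodel L M (V j t s) k + (Pmodel L M (V j t s) k)ᴴ + Matrix.diagonal (Z j t s k) with hPd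
    have hF : (fun s : ℝ => (avgTow (QBlev L M) ((L : ℝ) ^ d)
        (fun k' => (calDalev L M a ha k' + (Pmodel L M (V 0 t s) k' + (Pmodel L M (V 0 t s) k')ᴴ + Matrix.diagonal (Z 0 t s k')))⁻¹) k)⁻¹)
        = fun s : ℝ => (Φ (D + Pd 0 s)⁻¹)⁻¹ := by
      funext s; rw [hΦ]
    have hPdD : ∀ j v, HasDerivAt (Pd j) (Pd (j + 1) v) v :=
      fun j v => hasDerivAt_couplingLetter_curve L M (fun j s k μ x => hVd j t s k μ x) (fun j s k x => hZd j t s k x) k j v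
    have hG : Φ (D + Pd 0 0)⁻¹ = avgTow (QBlev L M) ((L : ℝ) ^ d)
        (fun k' => (calDalev L M a ha k' + (Pmodel L M (V 0 t 0) k' + (Pmodel L M (V 0 t 0) k')ᴴ + Matrix.diagonal (Z 0 t 0 k')))⁻¹) k :=
      (hΦ (fun k' => (calDalev L M a ha k' + (Pmodel L M (V 0 t 0) k' + (Pmodel L M (V 0 t 0) k')ᴴ + Matrix.diagonal (Z 0 t 0 k')))⁻¹)).symm
    have h0' : IsUnit (D + Pd 0 0).det := h0
    have hc0 : IsUnit (Φ (D + Pd 0 0)⁻¹).det := by rw [hG]; exact hc0'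
    rw [hF, hN D Pd Φ 0 hPdD h0' hc0, Finset.sum_apply, Finset.sum_apply]
    refine Finset.sum_congr rfl fun i _ => ?_
    rw [Pi.smul_apply, Pi.smul_apply, Pi.list_prod_apply, Pi.list_prod_apply, List.map_map, List.map_map, List.map_map]
    congr 1
    refine congrArg List.prod (List.map_congr_left fun o ho => ?_)
    cases o with
    | none =>
      simp only [Function.comp_apply, Option.map_none, Option.elim, one_smul]
      rw [hG]
    | some w =>
      simp only [Function.comp_apply, Option.map_some, Option.elim, one_smul]
      rw [hΦ, List.foldr_map]
      refine congrArg Φ (List.foldr_ext _ _ _ fun j hj Nm => ?_)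
      obtain ⟨-, hjN⟩ := hℓ i w ho j hj
      have ej : ((τ j : Fin (N + 1)) : ℕ) = j := hτv j hjN
      simp only [hPd, hD, ej]
      rfl
  -- PART 264's pointwise limits, read on the tower family through the identity
  intro μ' ν' x
  refine (hIVL k μ' ν' x).congr fun t => ?_
  beta_reduce
  rw [key t]

end Curve

/-! ## §2 THE INSTANCE: the exact abelian covariant Laplacian along a smooth transporter curve through a small BASE transporter -/

section Covariant

/-- **`conv_iteratedDeriv_invCov_covariantCurveAt_of_tendsto` — EVERY s-DERIVATIVE AT `s = 0` OF `(c_k(s))⁻¹` ALONG THE EXACT ABELIAN COVARIANT LAPLACIAN OF A SMOOTH TRANSPORTER CURVE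
`U_{t,s}` THROUGH A SMALL BASE TRANSPORTER `U_{t,0}`, ON `ℤ^d`** [our proof] (`d ≥ 3`, `L ≥ 2`, `a > 0`, `μ ≠ ν`, even cubic volumes `2(t+1)`, order `N`).  Data: for every volume `t`, a
REAL curve of abelian transporters on every level, ENTRYWISE `C^∞` in `s`; at `s = 0` the base connection `−w(U_{t,0}) = connV U_{t,0}` is Lipschitz `(α₀, β₀)` and `z(U_{t,0}) = zT U_{t,0}`
bounded `(α₀′, β₀′)` uniformly in `t` on the three-condition disc at coupling `1`; for `j ≤ N` the jets `x ↦ ∂^j_s(−w_{t,s})^{(k)}_ν(x)|₀` are Lipschitz `(α, β)` and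
`x ↦ ∂^j_s z^{(k)}_{t,s}(x)|₀` bounded `(α′, β′)` uniformly in `t`, with EL₁.  THEN the tower family `(t, k) ↦ ∂^N_s[(L^{dk}Q_k(Δ_a^{(k)} + (Δ^{U_{t,s},(k)} − Δ^{1,(k)}))⁻¹Q_kᴴ)⁻¹]|_{s=0}`
(`Δ^{U} − Δ^{1} = covPert U`, NE2) has the β-cell's whole `LimitRate` END — §1 on the entrywise iterated-derivative jets (PART 242 §1) and `covPert_eq`.  PART 242 is `U_{t,0} = 1`.
[cite: Balaban1985BackgroundPropagators, (3.3) p.390 (covariant derivative, shape); Balaban1987RG1, (1.20)–(1.22) p.264 (shapes)] -/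
theorem conv_iteratedDeriv_invCov_covariantCurveAt_of_tendsto (hL : 2 ≤ L) (hd : 3 ≤ d) {μ ν : Fin d} (hne : μ ≠ ν)
    {α₀ β₀ α₀' β₀' α β α' β' a' κ : ℝ} (ha' : 0 < a') (hκ0 : 0 < κ)
    (hγ' : Jfree d a' κ 1 < gammaPs d a') (hδ' : deltaK d a' κ 1 < sigma0 d a' ^ 2) (hJA : JA d a a' κ 1 < gamD d a)
    (hT₁ : 1 * (2 * (d * (α₀ + β₀) * Cst d a) + α₀' * Cst d a) ≤ 1 / 2)
    (hT₂ : 1 * (d * (α₀ * G2 d a (max (JA d a a' κ 1) 0) (gamD d a - max (JA d a a' κ 1) 0) κ)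
      + d * (Real.exp |κ| * (α₀ * G2 d a (max (JA d a a' κ 1) 0) (gamD d a - max (JA d a a' κ 1) 0) κ + β₀ * (gamD d a - max (JA d a a' κ 1) 0)⁻¹))
      + α₀' * (gamD d a - max (JA d a a' κ 1) 0)⁻¹) ≤ 1 / 2)
    (hT₃ : 4 * 1 * (2 * (d * (α₀ + β₀) * Cst d a) + α₀' * Cst d a) * Cst d a ≤ gammaB d a) (N : ℕ)
    {U : (t : ℕ) → ℝ → (k : ℕ) → Fin d → (idx L (cubic d (evenPeriod t)) k → ℂ)}
    (hU : ∀ t k ν' x, ∀ n : ℕ, ContDiff ℝ n (fun s => U t s k ν' x))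
    (hw : ∀ t, LipschitzBackground L (cubic d (evenPeriod t)) (connV L (cubic d (evenPeriod t)) (U t 0)) α₀ β₀)
    (hz : ∀ t, BoundedBackground L (cubic d (evenPeriod t)) (zT L (cubic d (evenPeriod t)) (U t 0)) α₀' β₀')
    (hV : ∀ j, j ≤ N → ∀ t, LipschitzBackground L (cubic d (evenPeriod t))
      (fun k ν' x => iteratedDeriv j (fun s => connV L (cubic d (evenPeriod t)) (U t s) k ν' x) 0) α β)
    (hZ : ∀ j, j ≤ N → ∀ t, BoundedBackground L (cubic d (evenPeriod t)) (fun k x => iteratedDeriv j (fun s => zT L (cubic d (evenPeriod t)) (U t s) k x) 0) α' β')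
    (hV1 : ∀ j, j ≤ N → ∀ k (ν' f : Fin d) (z : Fin d → ℤ), ∃ s' : ℂ,
      Tendsto (fun t => iteratedDeriv j (fun s => connV L (cubic d (evenPeriod t)) (U t s) k ν' (castT (cubic d (lev L k * evenPeriod t)) z, f)) 0) atTop (𝓝 s'))
    (hZ1 : ∀ j, j ≤ N → ∀ k (f : Fin d) (z : Fin d → ℤ), ∃ s' : ℂ,
      Tendsto (fun t => iteratedDeriv j (fun s => zT L (cubic d (evenPeriod t)) (U t s) k (castT (cubic d (lev L k * evenPeriod t)) z, f)) 0) atTop (𝓝 s')) :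
    ∃ κ₁ B B' : ℝ, 0 < κ₁ ∧ 0 ≤ B ∧ 0 ≤ B' ∧ ∃ Pinf : ℕ → B12Beta.Kernel d,
      (∀ k, IsInfiniteVolumeLimit evenPeriod
        (fun t μ' ν' (z : Site d (evenPeriod t)) =>
          ((iteratedDeriv N (fun s : ℝ => (avgTow (QBlev L (cubic d (evenPeriod t))) ((L : ℝ) ^ d)
              (fun k' => (calDalev L (cubic d (evenPeriod t)) a ha k' + covPert L (cubic d (evenPeriod t)) (U t s) k')⁻¹) k)⁻¹) 0)
            ((unitIdx L (cubic d (evenPeriod t))).symm (z, μ')) ((unitIdx L (cubic d (evenPeriod t))).symm (0, ν'))).re) (Pinf k)) ∧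
      Beta.LimitRate.UniformDecay Pinf μ ν B (κ₁ / d) ∧ StepRate Pinf μ ν B' (κ₁ / d) (Real.sqrt ((L : ℝ)⁻¹)) ∧
      (∃ K : KernelInputs d Pinf, K.θ = Real.sqrt ((L : ℝ)⁻¹) ∧ K.c₀ = betaPrime510 d (B' / (1 - Real.sqrt ((L : ℝ)⁻¹))) (κ₁ / d) ∧ K.Pinf = limKernelOf Pinf ∧ K.μ = μ ∧ K.ν = ν) ∧
      (∀ k, |B12Beta.secondMoment (Pinf k) μ ν - B12Beta.secondMoment (limKernelOf Pinf) μ ν|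
          ≤ betaPrime510 d (B' / (1 - Real.sqrt ((L : ℝ)⁻¹))) (κ₁ / d) * Real.sqrt ((L : ℝ)⁻¹) ^ k) := by
  -- the entrywise jets of `−w` and `z`
  have hcV : ∀ t k (ν' : Fin d) (x : idx L (cubic d (evenPeriod t)) k) (n : ℕ), ContDiff ℝ n (fun s => connV L (cubic d (evenPeriod t)) (U t s) k ν' x) := by
    intro t k ν' x n
    simp only [connV, negConn]
    exact (contDiff_conn (fine (lev L k) (cubic d (evenPeriod t))) (u := fun s => U t s k) (fun ν i => hU t k ν i n) _ ν' x).neg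
  have hcZ : ∀ t k (x : idx L (cubic d (evenPeriod t)) k) (n : ℕ), ContDiff ℝ n (fun s => zT L (cubic d (evenPeriod t)) (U t s) k x) := by
    intro t k x n
    simp only [zT]
    exact contDiff_zfield (fine (lev L k) (cubic d (evenPeriod t))) (u := fun s => U t s k) (fun ν i => hU t k ν i n) _ x
  have h := conv_iteratedDeriv_invPertCov_couplingCurveAt_of_tendsto_background L a ha hL hd hne ha' hκ0 hγ' hδ' hJA hT₁ hT₂ hT₃ N
    (V := fun j t s k ν' x => iteratedDeriv j (fun v => connV L (cubic d (evenPeriod t)) (U t v) k ν' x) s)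
    (Z := fun j t s k x => iteratedDeriv j (fun v => zT L (cubic d (evenPeriod t)) (U t v) k x) s)
    (fun j t s k ν' x => hasDerivAt_iteratedDeriv_scalar (hcV t k ν' x) j s) (fun j t s k x => hasDerivAt_iteratedDeriv_scalar (hcZ t k x) j s)
    (fun t => by simpa only [iteratedDeriv_zero] using hw t) (fun t => by simpa only [iteratedDeriv_zero] using hz t)
    hV hZ hV1 hZ1
  have e : ∀ t s k', covPert L (cubic d (evenPeriod t)) (U t s) k'
      = Pmodel L (cubic d (evenPeriod t)) ((fun j t s k ν' x => iteratedDeriv j (fun v => connV L (cubic d (evenPeriod t)) (U t v) k ν' x) s) 0 t s) k'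
        + (Pmodel L (cubic d (evenPeriod t)) ((fun j t s k ν' x => iteratedDeriv j (fun v => connV L (cubic d (evenPeriod t)) (U t v) k ν' x) s) 0 t s) k')ᴴ
        + Matrix.diagonal ((fun j t s k x => iteratedDeriv j (fun v => zT L (cubic d (evenPeriod t)) (U t v) k x) s) 0 t s k') := by
    intro t s k'
    have e1 : ((fun j t s k ν' x => iteratedDeriv j (fun v => connV L (cubic d (evenPeriod t)) (U t v) k ν' x) s) 0 t s) = connV L (cubic d (evenPeriod t)) (U t s) := by
      funext k ν' x; simp only [iteratedDeriv_zero]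
    have e2 : ((fun j t s k x => iteratedDeriv j (fun v => zT L (cubic d (evenPeriod t)) (U t v) k x) s) 0 t s k') = zT L (cubic d (evenPeriod t)) (U t s) k' := by
      funext x; simp only [iteratedDeriv_zero]
    rw [e1, e2]
    exact covPert_eq L (cubic d (evenPeriod t)) (U t s) k'
  simp only [e]
  exact h

end Covariant

end Summit.QuantumFields.BalabanUV.Beta.GAN24.CovariantCurveTaylorAtBase

end
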